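import Literature.AnabelianGeometry.EtaleTheta.Discharge.Sec5Prop55SgpCupConjOfBiKummerData
import Literature.AnabelianGeometry.EtaleTheta.Discharge.Sec5CyclotomicRigidityOfBiKummerDataLaws
import HarnessLib

/-!
# [EtTh] Prop. 5.5 at the assembled §5 data with the leaf P55-L06c (`hcup`) REPLACED by the Galois-equivariance of the bi-Kummer cocycle of the root (pp. 327–328 / PDF pp. 101–102)

Mochizuki, *The étale theta function and its Frobenioid-theoretic manifestations*, Publ. RIMS **45** (2009)
[cite: MochizukiEtTh2009, Prop 5.5 p.327–328 (PDF pp.101–102)].  abc-iut cell, layer L2, sub-DAG `plan/L2/SUBDAG-EtTh-Thm56.md`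
(seat abc-iut-L6-t23 g4, row (R5) of abc-iut-L2-lead).  PROOF-ONLY re-assembly BY NAME (nothing edited upstream): abc-iut-w5-d020's
`ThetaFrobenioid.cyclotomicRigidity_ofBiKummerData_of_laws` (`Discharge/Sec5CyclotomicRigidityOfBiKummerDataLaws`, itself abc-iut-w4-d008's
`Thm56Sub.cyclotomicRigidity_of_laws` at the data) with its structural binder `hcup` — "`s^⊔-gp_N(g h g⁻¹) = s^⊓-gp_N(g) s^⊔-gp_N(h) s^⊓-gp_N(g)⁻¹`
over `(l·Δ_Θ)`" — DISCHARGED through this seat's equivalence `hcup_iff_pull_root_mul` (`Discharge/Sec5Prop55SgpCupConjOfBiKummerData`)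
from the condition (KR) on the §4 setting's Galois action and the root: for `y₀ ∈ Π^tp_X̲`, `y ∈ Π^tp_Ÿ̲` with `ρ(y)` over `(l·Δ_Θ)_{B_N}`,
`g^*(g₀^* x) · x = g^* x · g₀^* x` (`g₀ = ρ_{A_N}(ιX y₀)`, `g = ρ_{A_N}(ιX y)`, `x ∈ B(A_N^bs)` the rational function of the `N`-th root) — the
Galois-equivariance of the étale-theta bi-Kummer cocycle over `l·Δ_Θ` that print draws from "the detailed description of the 'étale theta
class' in Proposition 1.3" (Prop. 5.5 proof, p.327 (PDF p.101)); plus the dictionary law `hfrac` of `toB` (abc-iut-L2-t4's binder).  All other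
binders are those of `cyclotomicRigidity_ofBiKummerData_of_laws`, verbatim and in the same order (`hgal`, `hproj` stay named: abc-iut-w4-d099's
row).  HONEST FRAMING: a kernel-checked implication between typed statements about the assembled data; (KR) is a hypothesis (GAP-LEDGER
G-L6t23-3), not asserted; nothing of [EtTh] is asserted unconditionally; typed ≠ proved; no side is taken on [IUTchIII] Cor. 3.12.
-/

noncomputable section

namespace Literature.AnabelianGeometry.EtaleTheta

open CategoryTheory Opposite FrobenioidCyclotomicRigidity Literature.AlgebraicGeometry.Frobenioids

universe u₀ v₀ u v w

namespace ThetaFrobenioid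

variable {K : Type u₀} [Field K]
  {X : SemiGraphs.TemperedArithmeticGroup.{u₀} K} {D₀ : Type u₀} [Category.{v₀} D₀]
  {V : FrdIMonoidStub.{w}} {T₀ : RealifiedDivisorMonoids (D₀ := D₀) V} {D : Type u} [Category.{v} D]
  {VD : FrdICatStub.{u, v, w} D} {S : BiKummerSetting X T₀ D VD}
  {pullFrac : ∀ {A A' : S.C} (_ : A' ⟶ A), S.biratUnits A → S.biratUnits A'}
  {lv N : ℕ+} {l' : ℕ} {RD : RigidData.{max v w} N l'} {θ : S.biratUnits S.Aodot} {Bl : S.C}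
  {Pl : S.FractionPair θ Bl} {Rl : S.NthRoot θ Pl lv pullFrac}
  (h : ModelFrobenioid.Hypotheses S.tf.divisorMonoid S.tf.ratFnFunctor)
  (toB : ∀ A : S.C, S.biratUnits A →* S.tf.biratUnitsModel A) (Q : FrobenioidTheta.ThetaSubquotientStub.{w} D)
  (odd_l : Odd (lv : ℕ)) (R : S.NthRoot Rl.root Rl.pair N pullFrac) (ιX : RD.PiX ≃ₜ* X.Pi)
  (hopen : IsOpen ((S.galoisSurj R.AN.base R.αData.isGalois).ker : Set X.Pi)) (σ : Aut R.AN.base →* Aut R.AN)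
  (K' : Type w) [Field K'] (constEmb : K'ˣ →* S.tf.biratUnitsModel R.BN)
  (constEmb_injective : Function.Injective constEmb)
  (hdivc : ∀ g : Aut R.BN.base,
    ModelFrobenioid.div ((σ ((BiKummerSetting.NthRoot.baseIso S R).conjAut.symm g)).hom ≫ R.pair.num) =
      ModelFrobenioid.div R.pair.num)
  (hdivp : ∀ y : RD.PiYdd,
    ModelFrobenioid.div ((σ (S.galoisSurj R.AN.base R.αData.isGalois (ιX y.1))).hom ≫ R.pair.den) =
      ModelFrobenioid.div R.pair.den)

/-- **[EtTh] Prop. 5.5 (`CyclotomicRigidity (ofBiKummerData …) P hB`, existence ∧ uniqueness of the rigidity family) for the ASSEMBLED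
§5 data, with the structural leaf P55-L06c DISCHARGED modulo the Galois-equivariance (KR) of the bi-Kummer cocycle of the root over
`(l·Δ_Θ)`**: abc-iut-w5-d020's `cyclotomicRigidity_ofBiKummerData_of_laws` with `hcup := (hcup_iff_pull_root_mul … P).mpr hKR`.  Binders: those of
that theorem verbatim (η-side `hη₀ hdies`, coverage `e he hlift hpre hP`, the Prop. 5.2 (iii) pin `ν hK`, `hσ hgeom hconst hreach hLc hLi`, the
named structural leaves `hgal hproj`), then `hfrac` ([FrdI] Thm. 5.2 (ii) dictionary law of `toB`) and `hKR` in place of `hcup`.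
[cite: MochizukiEtTh2009, Prop 5.5 p.327–328 (PDF pp.101–102)] -/
theorem cyclotomicRigidity_ofBiKummerData_of_pullRoot
    (hB : (ofBiKummerData h toB Q odd_l R ιX hopen σ K' constEmb constEmb_injective hdivc hdivp).IsThetaSaturated
      (ofBiKummerData h toB Q odd_l R ιX hopen σ K' constEmb constEmb_injective hdivc hdivp).BN)
    (P : ThetaSubquotientProj (ofBiKummerData h toB Q odd_l R ιX hopen σ K' constEmb constEmb_injective hdivc hdivp))
    -- the η-side (abc-iut-w5-d123, P55-L02 at the carrier) and coverage
    {η₀ : RD.PiYdd → RD.mu} (hη₀ : η₀ ∈ RD.thetaCocycles)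
    (hdies : ∀ k : RD.PiYdd, rhoOfBiKummerData R ιX k = 1 → η₀ k = 1)
    (e : RD.mu → (ofBiKummerData h toB Q odd_l R ιX hopen σ K' constEmb constEmb_injective hdivc hdivp).lDeltaModN
      (ofBiKummerData h toB Q odd_l R ιX hopen σ K' constEmb constEmb_injective hdivc hdivp).BN)
    (he : Function.Surjective e)
    (hlift : ∀ a ∈ (ofBiKummerData h toB Q odd_l R ιX hopen σ K' constEmb constEmb_injective hdivc hdivp).HB,
      a ∈ P.pre _ → ∃ k : RD.PiYdd, (k : RD.PiX) ∈ RD.lDeltaTheta ∧ rhoOfBiKummerData R ιX k = a)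
    (hpre : ∀ k : RD.PiYdd, (k : RD.PiX) ∈ RD.lDeltaTheta → rhoOfBiKummerData R ιX k ∈ P.pre _)
    (hP : ∀ (k : RD.PiYdd) (hk : (k : RD.PiX) ∈ RD.lDeltaTheta) (hm : rhoOfBiKummerData R ιX k ∈ P.pre _),
      (QuotientGroup.mk (P.proj _ ⟨rhoOfBiKummerData R ιX k, hm⟩) :
          (ofBiKummerData h toB Q odd_l R ιX hopen σ K' constEmb constEmb_injective hdivc hdivp).lDeltaModN
            (ofBiKummerData h toB Q odd_l R ιX hopen σ K' constEmb constEmb_injective hdivc hdivp).BN) =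
        e (RD.thetaMod ⟨k, hk⟩))
    -- the ν-half of the Prop. 5.2 (iii) pin, for the descended η
    (ν : (ofBiKummerData h toB Q odd_l R ιX hopen σ K' constEmb constEmb_injective hdivc hdivp).lDeltaModN
        (ofBiKummerData h toB Q odd_l R ιX hopen σ K' constEmb constEmb_injective hdivc hdivp).BN ≃*
      (ofBiKummerData h toB Q odd_l R ιX hopen σ K' constEmb constEmb_injective hdivc hdivp).muTorsion
        (ofBiKummerData h toB Q odd_l R ιX hopen σ K' constEmb constEmb_injective hdivc hdivp).BN
        (ofBiKummerData h toB Q odd_l R ιX hopen σ K' constEmb constEmb_injective hdivc hdivp).N)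
    (hK : ∀ η : (ofBiKummerData h toB Q odd_l R ιX hopen σ K' constEmb constEmb_injective hdivc hdivp).HB →
        (ofBiKummerData h toB Q odd_l R ιX hopen σ K' constEmb constEmb_injective hdivc hdivp).lDeltaModN
          (ofBiKummerData h toB Q odd_l R ιX hopen σ K' constEmb constEmb_injective hdivc hdivp).BN,
      (∀ k : RD.PiYdd, η ⟨rhoOfBiKummerData R ιX k, Subgroup.mem_map_of_mem _ k.2⟩ = e (η₀ k)) →
        FrobenioidThetaBiKummer.ThetaPairKummerClass
          (ofBiKummerData h toB Q odd_l R ιX hopen σ K' constEmb constEmb_injective hdivc hdivp) η ν)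
    -- centrality of the geometric part (this seat, T56-L09b at the data)
    (hσ : ∀ g : Aut R.AN.base, ModelFrobenioid.baseMap (σ g).hom = g.hom)
    (hgeom : P.pre R.BN.base ≤ RD.aug.ker.map (rhoOfBiKummerData R ιX))
    (hconst : ∀ δ ∈ RD.aug.ker, ∀ τ : ModelFrobenioid.units R.BN,
      (S.tf.ratFnFunctor.map (rhoOfBiKummerData R ιX δ).hom.op).hom (ModelFrobenioid.unit τ.1.hom) =
        ModelFrobenioid.unit τ.1.hom)
    -- the transport step and its independence, the laws of the free subquotient stub
    (hreach : LinearlyReachableFromBN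
      (ofBiKummerData h toB Q odd_l R ιX hopen σ K' constEmb constEmb_injective hdivc hdivp))
    (hLc : Thm56Sub.LDeltaMapComp
      (ofBiKummerData h toB Q odd_l R ιX hopen σ K' constEmb constEmb_injective hdivc hdivp))
    (hLi : Thm56Sub.LDeltaMapId
      (ofBiKummerData h toB Q odd_l R ιX hopen σ K' constEmb constEmb_injective hdivc hdivp))
    -- the three structural leaves of abc-iut-w4-d008's `cyclotomicRigidity_of_laws` that stay NAMED at the data
    (hgal : ∀ (T : S.C),
      (ofBiKummerData h toB Q odd_l R ιX hopen σ K' constEmb constEmb_injective hdivc hdivp).IsThetaSaturated T →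
      ∀ (φ φ' : (ofBiKummerData h toB Q odd_l R ιX hopen σ K' constEmb constEmb_injective hdivc hdivp).BN ⟶ T),
        (ofBiKummerData h toB Q odd_l R ιX hopen σ K' constEmb constEmb_injective hdivc hdivp).IsLinear φ →
        (ofBiKummerData h toB Q odd_l R ιX hopen σ K' constEmb constEmb_injective hdivc hdivp).IsLinear φ' →
          ∃ g : Aut ((ofBiKummerData h toB Q odd_l R ιX hopen σ K' constEmb constEmb_injective hdivc hdivp).base.obj
              (ofBiKummerData h toB Q odd_l R ιX hopen σ K' constEmb constEmb_injective hdivc hdivp).BN),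
            (ofBiKummerData h toB Q odd_l R ιX hopen σ K' constEmb constEmb_injective hdivc hdivp).base.map φ' =
              g.hom ≫ (ofBiKummerData h toB Q odd_l R ιX hopen σ K' constEmb constEmb_injective hdivc hdivp).base.map φ)
    (hproj : ∀ (g g' : Aut ((ofBiKummerData h toB Q odd_l R ιX hopen σ K' constEmb constEmb_injective hdivc hdivp).base.obj
        (ofBiKummerData h toB Q odd_l R ιX hopen σ K' constEmb constEmb_injective hdivc hdivp).BN))
        (hh : g' ∈ P.pre _), ∃ hgh : g * g' * g⁻¹ ∈ P.pre _,
          (ofBiKummerData h toB Q odd_l R ιX hopen σ K' constEmb constEmb_injective hdivc hdivp).lDeltaMap g.hom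
              (P.proj _ ⟨g', hh⟩) = P.proj _ ⟨g * g' * g⁻¹, hgh⟩)
    -- P55-L06c: `hcup` REPLACED by the Galois-equivariance of the bi-Kummer cocycle of the root over `(l·Δ_Θ)`
    (hfrac : ∀ {A B : S.C} (s' s'' : A ⟶ B) (h' : S.IsPreStep s') (h'' : S.IsPreStep s'')
      (hb : PreFrobenioid.BaseEquivalent S.F s' s''),
      (toB A (S.fracOf s' s'' h' h'' hb) : S.tf.ratFnFunctor.obj (op A.base)) *
        ModelFrobenioid.unit s'' = ModelFrobenioid.unit s')
    (hKR : ∀ (y₀ y : RD.PiX), y ∈ RD.PiYdd → rhoOfBiKummerData R ιX y ∈ P.pre R.BN.base →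
        pull S.tf.ratFnFunctor (S.galoisSurj R.AN.base R.αData.isGalois (ιX y)).hom
            (pull S.tf.ratFnFunctor (S.galoisSurj R.AN.base R.αData.isGalois (ιX y₀)).hom
              (toB R.AN R.root : S.tf.ratFnFunctor.obj (op R.AN.base))) *
            (toB R.AN R.root : S.tf.ratFnFunctor.obj (op R.AN.base)) =
          pull S.tf.ratFnFunctor (S.galoisSurj R.AN.base R.αData.isGalois (ιX y)).hom
              (toB R.AN R.root : S.tf.ratFnFunctor.obj (op R.AN.base)) *
            pull S.tf.ratFnFunctor (S.galoisSurj R.AN.base R.αData.isGalois (ιX y₀)).hom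
              (toB R.AN R.root : S.tf.ratFnFunctor.obj (op R.AN.base))) :
    CyclotomicRigidity (ofBiKummerData h toB Q odd_l R ιX hopen σ K' constEmb constEmb_injective hdivc hdivp) P hB :=
  cyclotomicRigidity_ofBiKummerData_of_laws h toB Q odd_l R ιX hopen σ K' constEmb constEmb_injective hdivc hdivp hB P hη₀ hdies e he hlift hpre hP ν hK hσ hgeom hconst hreach hLc
    hLi hgal hproj ((hcup_iff_pull_root_mul h toB Q odd_l R ιX hopen σ K' constEmb constEmb_injective hdivc hdivp hσ hfrac P).mpr hKR)

end ThetaFrobenioid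

end Literature.AnabelianGeometry.EtaleTheta

end
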